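import Literature.Probability.Percolation.LowestCrossing
import Literature.Probability.Percolation.RSWLemma
import Literature.Probability.Percolation.CornerPercolation
import HarnessLib

/-!
# Vocabulary of line `Sketch` for the crux `UniformBoxCrossing` (stmt-CriticalPhenomena-5476), part 1:
# two stacked squares — hulls, regions, gap, JOIN and small-gap events

Definitions-only support file of the lead's skeleton (`Cruxes/UniformBoxCrossing/Lines/Sketch.lean`,
route `CardySelfDualSegment` of `CriticalPhenomena/CardyFormulaZ2`). It fixes the VOCABULARY in
which the engine stub of the line (Bollobás–Riordan 2010, arXiv:1001.4674, §5.1: Lemma 5.6 and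
the proof of Theorem 5.3, transplanted to the corner models `M_t = cornerPercolation t`) is
decomposed into registered worker stubs; part 2 (`…UniformBoxCrossingDefs2.lean`) adds the corner
bookkeeping, the resampling map and the stub statements. Nothing is asserted here.

Bollobás–Riordan work with two `n`-squares `S₁ = [0, n]²` and `S₂ = S₁ + (0, s)`, the lowest open
horizontal crossing `P₁ = LH(S₁)` found by exploring `S₁` from below, the highest open horizontal
crossing `P₂ = UH(S₂)` found by exploring `S₂` from above, the region `A` of the strip
`T = [0, n] × ℤ` on or below `P₁`, the region `B` on or above `P₂`, the gap `G = T \ (A ∪ B)`,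
and the events `J(S₁, S₂)` (joined crossings) and `G_ε(S₁, S₂)` (small gap).

Design (all objects are CANONICAL functions of the explored face sets, no chosen paths):

* Exploration from below is the tree's `dualBelow n ω` (faces of the dual square dual-joined to
  its bottom row, `LowestCrossing.lean`). The region below the lowest crossing is rendered by the
  **lower hull** `lowerHull n ω`: the faces of the dual square that cannot be reached from its top
  row by a path of faces avoiding `dualBelow n ω` (the explored region with its holes — the open
  bubbles hanging below the lowest crossing — filled in). `lowerRegion n ω` (B–R's `A`) is the set
  of lattice points that are a corner of a lower-hull face, plus every point strictly below the
  square. The lowest crossing itself is the interface between the hull and its complement; it is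
  produced when needed by `exists_bdryWalk` applied to the hull (`exists_lowerInterfaceWalk`), and
  every such interface walk is a boundary walk of `dualBelow n ω`
  (`isBdryEdge_dualBelow_of_isBdryEdge_lowerHull`), so the winding-number toolkit of
  `LowestCrossingInterface.lean` applies to it. (Chosen simple boundary PATHS of `dualBelow` would
  not do: such a path may shortcut below a bubble, and then the regions of stacked squares are not
  monotone in the square, which B–R's Lemma 5.6 needs.)
* Exploration of the upper square `S₂ = [0, n] × [s, n + s]` from above is exploration from below
  of the configuration reflected in the horizontal line `x₁ = (n + s)/2`
  (`upperRefl n s = reflY (n + s)`, which swaps `S₁` and `S₂`): `reflConfig`, `dualAbove`,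
  `upperRegion` (B–R's `B`).
* `gap n s ω` (B–R's `G ∩ (S₁ ∪ S₂)`) is a `Finset`, so that "area `≤ ε n²`" is a cardinality
  bound; `joinEvent n k` is the JOIN event verbatim as consumed by the landed Lemma 5.4/5.5 files
  (`…StubJoin.lean`, `…StubBRChainPart1.lean`); `smallGapEvent n s m` is B–R's `G_ε` with
  "`P₁` strictly below `P₂`" rendered as "`A` and `B` do not meet inside `S₁ ∪ S₂`".

## References

* B. Bollobás, O. Riordan, *Percolation on self-dual polygon configurations*, Bolyai Soc. Math.
  Stud. 21 (2010) 131–217, arXiv:1001.4674, §5.1 (Lemmas 5.4–5.6, proof of Thm. 5.3).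
  [BollobasRiordan2010]
* H. Kesten, *Percolation theory for mathematicians*, Birkhäuser (1982), §2.2–2.3 (lowest
  crossing). [KestenPTM1982]
-/

noncomputable section

namespace Summit.CriticalPhenomena.CardyFormulaZ2.Cruxes.UniformBoxCrossing.NonSlantLine

open SimpleGraph Finset Literature.Probability.Percolation Literature.Probability.LatticeModels

/-! ### Lattice walks with free endpoints -/

/-- A walk in `ℤ²` packaged with its two endpoints (so that chosen walks can be values of
functions). [folklore] -/
structure XWalk where
  /-- the first vertex -/
  fst : Site 2
  /-- the last vertex -/
  snd : Site 2
  /-- the walk -/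
  walk : (zdGraph 2).Walk fst snd

namespace XWalk

/-- The trivial walk at `v`. [folklore] -/
def nil (v : Site 2) : XWalk := ⟨v, v, Walk.nil⟩

/-- The vertices of the walk, as a `Finset`. [folklore] -/
def verts (w : XWalk) : Finset (Site 2) := w.walk.support.toFinset

/-- Membership in `verts`. [folklore] -/
@[simp] theorem mem_verts {w : XWalk} {z : Site 2} : z ∈ w.verts ↔ z ∈ w.walk.support := by
  simp [verts]

/-- The image of the walk under an automorphism of `ℤ²`. [folklore] -/
def map (φ : zdGraph 2 ≃g zdGraph 2) (w : XWalk) : XWalk :=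
  ⟨φ w.fst, φ w.snd, w.walk.map φ.toEmbedding.toHom⟩

/-- The translate `w + X` of the walk. [folklore] -/
def shift (w : XWalk) (X : Site 2) : XWalk := w.map (zdShiftIso X)

/-- Endpoints of the translate. [folklore] -/
@[simp] theorem shift_fst (w : XWalk) (X : Site 2) : (w.shift X).fst = w.fst + X := rfl

/-- Endpoints of the translate. [folklore] -/
@[simp] theorem shift_snd (w : XWalk) (X : Site 2) : (w.shift X).snd = w.snd + X := rfl

/-- Vertices of the translate. [folklore] -/
theorem mem_support_shift {w : XWalk} {X z : Site 2} :
    z ∈ (w.shift X).walk.support ↔ z - X ∈ w.walk.support := by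
  simp only [shift, map, Walk.support_map, List.mem_map]
  constructor
  · rintro ⟨y, hy, rfl⟩
    simpa using hy
  · intro h
    exact ⟨z - X, h, by simp⟩

/-- Edges of the translate. [folklore] -/
theorem mem_edges_shift {w : XWalk} {X : Site 2} {e : Sym2 (Site 2)} :
    e ∈ (w.shift X).walk.edges ↔ ∃ e₀ ∈ w.walk.edges, e = e₀.map (· + X) := by
  simp only [shift, map, Walk.edges_map, List.mem_map]
  constructor
  · rintro ⟨e₀, he₀, rfl⟩; exact ⟨e₀, he₀, rfl⟩
  · rintro ⟨e₀, he₀, rfl⟩; exact ⟨e₀, he₀, rfl⟩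

end XWalk

/-! ### The four faces around a vertex, the corner of an edge -/

/-- The four faces of `ℤ²` (indexed by lower-left corners) having `v` as a corner:
`v`, `v - e₀`, `v - e₁`, `v - e₀ - e₁`. [folklore] -/
def facesAt (v : Site 2) : Finset (Site 2) :=
  {v, v - Pi.single 0 1, v - Pi.single 1 1, v - Pi.single 0 1 - Pi.single 1 1}

/-- Membership in `facesAt`. [folklore] -/
theorem mem_facesAt_iff {v g : Site 2} :
    g ∈ facesAt v ↔ g = v ∨ g = v - Pi.single 0 1 ∨ g = v - Pi.single 1 1 ∨
      g = v - Pi.single 0 1 - Pi.single 1 1 := by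
  simp [facesAt]

/-- `g ∈ facesAt v` iff `v` is one of the four corners of the face `g`. [folklore] -/
theorem mem_facesAt_iff' {v g : Site 2} :
    g ∈ facesAt v ↔ v = g ∨ v = g + Pi.single 0 1 ∨ v = g + Pi.single 1 1 ∨
      v = g + Pi.single 0 1 + Pi.single 1 1 := by
  rw [mem_facesAt_iff]
  constructor
  · rintro (rfl | rfl | rfl | rfl)
    · exact Or.inl rfl
    · exact Or.inr (Or.inl (by abel))
    · exact Or.inr (Or.inr (Or.inl (by abel)))
    · exact Or.inr (Or.inr (Or.inr (by abel)))
  · rintro (rfl | rfl | rfl | rfl)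
    · exact Or.inl rfl
    · exact Or.inr (Or.inl (by abel))
    · exact Or.inr (Or.inr (Or.inl (by abel)))
    · exact Or.inr (Or.inr (Or.inr (by abel)))

/-- The **corner** of a pair of lattice points: their infimum in the product order. For a
lattice edge `{v, v + eᵢ}` this is `v`, the vertex whose coins decide the edge in the corner
model (`cornerEdge (v, i) = {v, v + eᵢ}`). [folklore] -/
def cornerOf : Sym2 (Site 2) → Site 2 :=
  Sym2.lift ⟨fun x y => x ⊓ y, fun _ _ => inf_comm _ _⟩

/-- `cornerOf {x, y} = x ⊓ y`. [folklore] -/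
@[simp] theorem cornerOf_mk (x y : Site 2) : cornerOf s(x, y) = x ⊓ y := rfl

/-- The corner of `cornerEdge (v, i) = {v, v + eᵢ}` is `v`. [folklore] -/
@[simp] theorem cornerOf_cornerEdge (i : Site 2 × Fin 2) : cornerOf (cornerEdge i) = i.1 := by
  rw [cornerEdge, cornerOf_mk]
  exact inf_eq_left.2 (le_add_of_nonneg_right (Pi.single_nonneg.2 zero_le_one))

/-! ### The lower hull and the lower region of the square `[0, n]²` -/

section Lower

variable (n : ℕ)

/-- A face `f` of the dual square `S* = dualRectangle n n` is **top-free** for the explored set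
`D` if it is joined to a top face of `S*` by a path of pairwise adjacent faces of `S*` avoiding
`D` (all lattice edges "open": `openCrossing` for the full edge set). [folklore] -/
def TopFree (D : Finset (Site 2)) (f : Site 2) : Prop :=
  (zdGraph 2).edgeSet ∈ openCrossing ((↑(dualRectangle n n) : Set (Site 2)) \ ↑D)
    ↑(dualTopSide n n) {f}

/-- The **lower hull** of `ω` in `[0, n]²`: the faces of the dual square that are not top-free
for `dualBelow n ω` — the explored region `dualBelow n ω` with its holes filled; on `H([0,n]²)`
these are exactly the faces below the lowest open left–right crossing (Bollobás–Riordan 2010,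
§5.1: "explore `S₁` from below … `A` = the part of the strip on or below `P₁`").
[cite: BollobasRiordan2010, §5.1 proof of Thm. 5.3] -/
def lowerHull (ω : BondConfig (Site 2)) : Finset (Site 2) := by
  classical
  exact (dualRectangle n n).filter fun f => ¬ TopFree n (dualBelow n ω) f

/-- Membership in the lower hull. [folklore] -/
theorem mem_lowerHull_iff {ω : BondConfig (Site 2)} {f : Site 2} :
    f ∈ lowerHull n ω ↔ f ∈ dualRectangle n n ∧ ¬ TopFree n (dualBelow n ω) f := by
  classical
  simp [lowerHull]

/-- The explored faces lie in the hull. [folklore] -/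
theorem dualBelow_subset_lowerHull (ω : BondConfig (Site 2)) : dualBelow n ω ⊆ lowerHull n ω := by
  intro f hf
  refine (mem_lowerHull_iff n).2 ⟨dualBelow_subset hf, ?_⟩
  rintro ⟨t, -, f', hf', -, hS, -⟩
  rw [Set.mem_singleton_iff] at hf'
  subst hf'
  exact hS.2 hf

/-- The lower hull only depends on the explored set. [folklore] -/
theorem lowerHull_congr {ω ω' : BondConfig (Site 2)} (h : dualBelow n ω = dualBelow n ω') :
    lowerHull n ω = lowerHull n ω' := by
  classical
  simp only [lowerHull, h]

/-- **B–R's region `A`** ("on or below the lowest crossing of `S₁ = [0, n]²`"): the lattice points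
that are a corner of a lower-hull face, together with every point strictly below the square.
[cite: BollobasRiordan2010, §5.1 proof of Thm. 5.3] -/
def lowerRegion (ω : BondConfig (Site 2)) : Set (Site 2) :=
  {v | v 1 < 0 ∨ ∃ g ∈ facesAt v, g ∈ lowerHull n ω}

/-- Membership in the lower region. [folklore] -/
theorem mem_lowerRegion_iff {ω : BondConfig (Site 2)} {v : Site 2} :
    v ∈ lowerRegion n ω ↔ v 1 < 0 ∨ ∃ g ∈ facesAt v, g ∈ lowerHull n ω := Iff.rfl

/-- The lower region only depends on the explored set. [folklore] -/
theorem lowerRegion_congr {ω ω' : BondConfig (Site 2)} (h : dualBelow n ω = dualBelow n ω') :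
    lowerRegion n ω = lowerRegion n ω' := by
  simp only [lowerRegion, lowerHull_congr n h]

/-- A boundary edge of the hull is a boundary edge of the explored set: the face outside the
hull is top-free, hence so would be the face inside if it were not explored. [folklore] -/
theorem isBdryEdge_dualBelow_of_isBdryEdge_lowerHull {ω : BondConfig (Site 2)} {e : Sym2 (Site 2)}
    (he : e ∈ (zdGraph 2).edgeSet) (h : IsBdryEdge (lowerHull n ω) n e) :
    IsBdryEdge (dualBelow n ω) n e := by
  obtain ⟨g, g', hde, hg, hg', hgH, hg'H⟩ := h
  refine ⟨g, g', hde, hg, hg', ?_, fun hg'D => hg'H (dualBelow_subset_lowerHull n ω hg'D)⟩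
  by_contra hgD
  have hfree' : TopFree n (dualBelow n ω) g' := by
    by_contra h'
    exact hg'H ((mem_lowerHull_iff n).2 ⟨hg', h'⟩)
  apply ((mem_lowerHull_iff n).1 hgH).2
  obtain ⟨t, ht, f', hf', hconn⟩ := hfree'
  rw [Set.mem_singleton_iff] at hf'
  subst f'
  refine ⟨t, ht, g, rfl, PlanarDuality.openConnIn_trans hconn ?_⟩
  have hgg' : (zdGraph 2).Adj g' g := by
    have hE : s(g, g') ∈ (zdGraph 2).edgeSet := hde ▸ dualEdge_mem_edgeSet_holds he
    exact ((zdGraph 2).mem_edgeSet.1 hE).symm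
  exact openConnIn_of_adj ⟨Finset.mem_coe.2 hg', fun h => ((mem_lowerHull_iff n).1
      (dualBelow_subset_lowerHull n ω h)).2 ⟨t, ht, g', rfl, hconn⟩⟩
    ⟨Finset.mem_coe.2 hg, hgD⟩ ((zdGraph 2).mem_edgeSet.2 hgg') hgg'.ne

/-- **The lowest crossing as an interface walk.** On `H([0, n]²)` (no top face explored) there
is a lattice walk in `[0, n]²` from the left side to the right side all of whose edges are
boundary edges of the lower hull (`exists_bdryWalk` for the hull: the bottom faces are explored,
the top faces are top-free). Such a walk is a boundary walk of `dualBelow n ω`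
(`isBdryEdge_dualBelow_of_isBdryEdge_lowerHull`), hence open (`mem_of_isBdryEdge`), and it uses
no edge of a bubble. [cite: BollobasRiordan2010, §5.1 proof of Thm. 5.3] -/
theorem exists_lowerInterfaceWalk {ω : BondConfig (Site 2)}
    (htop : ∀ f ∈ dualTopSide n n, f ∉ dualBelow n ω) :
    ∃ w : XWalk, IsSquareCrossing n w.walk ∧ ∀ d ∈ w.walk.darts, IsBdryEdge (lowerHull n ω) n d.edge := by
  have hbot : ∀ f ∈ dualBottomSide n n, f ∈ lowerHull n ω := fun f hf =>
    dualBelow_subset_lowerHull n ω (mem_dualBelow_of_mem_dualBottomSide hf)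
  have htop' : ∀ f ∈ dualTopSide n n, f ∉ lowerHull n ω := by
    intro f hf hfH
    refine ((mem_lowerHull_iff n).1 hfH).2 ⟨f, hf, f, rfl, openConnIn_refl ?_⟩
    exact ⟨Finset.mem_coe.2 (Finset.mem_filter.1 hf).1, htop f hf⟩
  obtain ⟨a, b, ha, hb, π, hπ, hd⟩ := exists_bdryWalk hbot htop'
  exact ⟨⟨a, b, π⟩, ⟨hπ, ha, hb⟩, hd⟩

end Lower

/-! ### The upper square `[0, n] × [s, n + s]`, explored from above -/

section Upper

variable (n s : ℕ)

/-- The reflection in the horizontal line `x₁ = (n + s)/2`; it swaps `S₁ = [0, n]²` and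
`S₂ = [0, n] × [s, n + s]`, top and bottom. [folklore] -/
def upperRefl : zdGraph 2 ≃g zdGraph 2 := reflY ((n : ℤ) + s)

/-- Coordinates of the reflection. [folklore] -/
@[simp] theorem upperRefl_apply_zero (v : Site 2) : upperRefl n s v 0 = v 0 := by
  simp [upperRefl]

/-- Coordinates of the reflection. [folklore] -/
@[simp] theorem upperRefl_apply_one (v : Site 2) : upperRefl n s v 1 = n + s - v 1 := by
  simp [upperRefl]

/-- The reflection is an involution. [folklore] -/
@[simp] theorem upperRefl_upperRefl (v : Site 2) : upperRefl n s (upperRefl n s v) = v := by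
  simp [upperRefl]

/-- The reflected configuration: the lattice edge `e` is open in `reflConfig n s ω` iff its
reflection is open in `ω`. [folklore] -/
def reflConfig (ω : BondConfig (Site 2)) : BondConfig (Site 2) :=
  BondConfig.relabel (sym2Equiv (upperRefl n s).toEquiv) ω

/-- Membership in the reflected configuration. [folklore] -/
theorem mem_reflConfig_iff (ω : BondConfig (Site 2)) (e : Sym2 (Site 2)) :
    e ∈ reflConfig n s ω ↔ e.map (upperRefl n s) ∈ ω := by
  rw [reflConfig, BondConfig.mem_relabel_iff, sym2Equiv_symm, sym2Equiv_apply]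
  have : ⇑((upperRefl n s).toEquiv.symm) = ⇑(upperRefl n s) := by
    funext x
    apply (upperRefl n s).toEquiv.injective
    rw [Equiv.apply_symm_apply]
    exact (upperRefl_upperRefl n s x).symm
  rw [this]

/-- **Exploration of the upper square from above**: the faces of the dual square of
`S₂ = [0, n] × [s, n + s]` dual-joined inside it to its top row, obtained by exploring the
reflected configuration from below and reflecting the faces back (`reflY (n + s - 1)` on faces
realises `reflY (n + s)` on the lattice, `dualEdge_map_reflY`). On `H(S₂)` its complement's
interface is the highest open left–right crossing `UH(S₂)` of Bollobás–Riordan.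
[cite: BollobasRiordan2010, §5.1 proof of Thm. 5.3] -/
def dualAbove (ω : BondConfig (Site 2)) : Finset (Site 2) :=
  (dualBelow n (reflConfig n s ω)).image (reflY ((n : ℤ) + s - 1))

/-- **B–R's region `B`** ("on or above the highest crossing of `S₂`"): the reflection of the lower
region of the reflected configuration (so it contains every point strictly above `S₂`).
[cite: BollobasRiordan2010, §5.1 proof of Thm. 5.3] -/
def upperRegion (ω : BondConfig (Site 2)) : Set (Site 2) :=
  {v | upperRefl n s v ∈ lowerRegion n (reflConfig n s ω)}

/-- Membership in the upper region. [folklore] -/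
theorem mem_upperRegion_iff {ω : BondConfig (Site 2)} {v : Site 2} :
    v ∈ upperRegion n s ω ↔ upperRefl n s v ∈ lowerRegion n (reflConfig n s ω) := Iff.rfl

/-- The reflected explored set is determined by `dualAbove` (the face reflection is injective).
[folklore] -/
theorem dualBelow_reflConfig_eq_of_dualAbove_eq {ω ω' : BondConfig (Site 2)}
    (h : dualAbove n s ω = dualAbove n s ω') :
    dualBelow n (reflConfig n s ω) = dualBelow n (reflConfig n s ω') :=
  Finset.image_injective (reflY ((n : ℤ) + s - 1)).injective h

/-- The upper region only depends on the upper explored set. [folklore] -/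
theorem upperRegion_congr {ω ω' : BondConfig (Site 2)} (h : dualAbove n s ω = dualAbove n s ω') :
    upperRegion n s ω = upperRegion n s ω' := by
  simp only [upperRegion, lowerRegion_congr n (dualBelow_reflConfig_eq_of_dualAbove_eq n s h)]

/-- Points strictly above `S₂` lie in the upper region. [folklore] -/
theorem mem_upperRegion_of_lt {ω : BondConfig (Site 2)} {v : Site 2} (hv : (n : ℤ) + s < v 1) :
    v ∈ upperRegion n s ω := by
  rw [mem_upperRegion_iff, mem_lowerRegion_iff]
  left
  rw [upperRefl_apply_one]
  omega

/-- The upper square `S₂ = [0, n]² + (0, s)`. [folklore] -/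
def upperSquare : Set (Site 2) := (· + ![0, (s : ℤ)]) '' ↑(rectangle n n)

/-- The event `H(S₂)`: an open left–right crossing of the upper square (in the translated form
used by `cornerPercolation_real_openCrossing_shift`). [folklore] -/
def upperLR : Set (BondConfig (Site 2)) :=
  openCrossing (upperSquare n s) ((· + ![0, (s : ℤ)]) '' ↑(leftSide n n))
    ((· + ![0, (s : ℤ)]) '' ↑(rightSide n n))

/-- **B–R's gap** `G ∩ (S₁ ∪ S₂)`: the lattice points of `[0, n] × [0, n + s]` neither in the lower
region of `S₁` nor in the upper region of `S₂`; its cardinality is the "area between `P₁` and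
`P₂`". [cite: BollobasRiordan2010, §5.1 Lemma 5.6] -/
def gap (ω : BondConfig (Site 2)) : Finset (Site 2) := by
  classical
  exact (rectangle n (n + s)).filter fun v => v ∉ lowerRegion n ω ∧ v ∉ upperRegion n s ω

/-- Membership in the gap. [folklore] -/
theorem mem_gap_iff {ω : BondConfig (Site 2)} {v : Site 2} :
    v ∈ gap n s ω ↔ v ∈ rectangle n (n + s) ∧ v ∉ lowerRegion n ω ∧ v ∉ upperRegion n s ω := by
  classical
  simp [gap]

/-- **The JOIN event `J(S₁, S₂)`** of Bollobás–Riordan for `S₁ = [0, n]²`, `S₂ = S₁ + (0, k)`: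
open horizontal crossings `a₁ ↔ b₁` of `S₁` and `a₂ + (0,k) ↔ b₂ + (0,k)` of `S₂` with
`a₁ ↔ a₂ + (0, k)` inside `S₁ ∪ S₂ = [0, n] × [0, n + k]` (verbatim the event consumed by the
Lemma 5.4/5.5 files of the tree). [cite: BollobasRiordan2010, §5.1 Lemma 5.5] -/
def joinEvent (n k : ℕ) : Set (BondConfig (Site 2)) :=
  {ω | ∃ a₁ ∈ leftSide n n, ∃ b₁ ∈ rightSide n n, ∃ a₂ ∈ leftSide n n, ∃ b₂ ∈ rightSide n n,
    ω ∈ openConnIn (↑(rectangle n n)) a₁ b₁ ∧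
    ω ∈ openConnIn ((· + ![0, (k : ℤ)]) '' ↑(rectangle n n)) (a₂ + ![0, (k : ℤ)])
      (b₂ + ![0, (k : ℤ)]) ∧
    ω ∈ openConnIn (↑(rectangle n (n + k))) a₁ (a₂ + ![0, (k : ℤ)])}

/-- **The small-gap event `G_ε(S₁, S₂)`** of Bollobás–Riordan (Lemma 5.6), with area bound `m`:
both squares are crossed horizontally, the lower region of `S₁` and the upper region of `S₂` do
not meet inside `S₁ ∪ S₂` ("`LH(S₁)` strictly below `UH(S₂)`"), and the gap has at most `m`
lattice points. [cite: BollobasRiordan2010, §5.1 Lemma 5.6] -/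
def smallGapEvent (m : ℕ) : Set (BondConfig (Site 2)) :=
  {ω | ω ∈ lrCrossing n n ∧ ω ∈ upperLR n s ∧
    (∀ v ∈ rectangle n (n + s), v ∈ lowerRegion n ω → v ∉ upperRegion n s ω) ∧
    (gap n s ω).card ≤ m}

end Upper

/-! ### Registered glue -/

/-- Statement form of `exists_lowerInterfaceWalk` — "on `H([0,n]²)` the lowest crossing exists as
an interface walk of the lower hull": a registered glue step the LINE POSITS and proves right
below (`lowerInterfaceWalk_holds`); not a literature fact, never to be relocated. -/
def LowerInterfaceWalkStatement : Prop :=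
  ∀ (n : ℕ) (ω : BondConfig (Site 2)), (∀ f ∈ dualTopSide n n, f ∉ dualBelow n ω) →
    ∃ w : XWalk, IsSquareCrossing n w.walk ∧ ∀ d ∈ w.walk.darts, IsBdryEdge (lowerHull n ω) n d.edge

/-- The lowest crossing exists as an interface walk of the lower hull. [cite: BollobasRiordan2010, §5.1 proof of Thm. 5.3] -/
theorem lowerInterfaceWalk_holds : LowerInterfaceWalkStatement := fun n _ h => exists_lowerInterfaceWalk n h

end Summit.CriticalPhenomena.CardyFormulaZ2.Cruxes.UniformBoxCrossing.NonSlantLine
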